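import Summits.CriticalPhenomena.PercolationContinuityZ3.Theorems.PercAnnulusCrossingSetToSetQuasiMult
import Summits.CriticalPhenomena.PercolationContinuityZ3.Theorems.PercAnnulusCrossingBoxCrossingDefs
import HarnessLib

/-!
# RSW3 lane: the typed (A2)□ (`Crossing.SetToSetQuasiMultAt`, defs v3) implies the lane's (S2) statements

builds on p205010 (kernel theorem, internal audit signed; external expert review pending)

RSW3 lane (LANE 3), lead seat gen 2 — a two-line bridge between the defs-file Prop `Crossing.SetToSetQuasiMultAt`
(Basu–Sapozhnikov's (A2) in `ℓ^∞`-box form, p218759) and seat p1's unfolded theorems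
`Crossing.doubling_four_of_setToSetQM` / `oneArmDoubling_of_setToSetQM` (p217796); the two hypotheses differ only in the
bracketing `ϰ · (P₁ · P₂)` versus `ϰ · P₁ · P₂`.  No definitions, no sorries.

* `oneArmDoubling_four_of_setToSetQuasiMultAt` — every `d ≥ 2`: (A2)□ at `p_c(ℤ^d)` ⇒ `∃ c > 0, ∀ n ≥ 1, c·π(n) ≤ π(4n)`;
* `oneArmDoubling_of_setToSetQuasiMultAt`, `oneArmDoubling_of_setToSetQuasiMult` — on `ℤ³`:
  `SetToSetQuasiMult → OneArmQuasiMult ∧ OneArmDoubling`.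

So the single open input of Basu–Sapozhnikov's IIC theorem for `ℤ³` (their Thm. 1.1) sits ABOVE the lane's (S2) column:
(A2)□ ⇒ QM ⇒ doubling (and numerically doubling holds, `D(n) ≈ 0.718` flat; non-rigorous).
[cite: BasuSapozhnikov2017ECP, §1 (A2) and Thm. 1.1]
-/

noncomputable section

namespace Summit.CriticalPhenomena.PercolationContinuityZ3.Theorems.Crossing

open MeasureTheory Literature.Probability.LatticeModels Literature.Probability.Percolation

/-- **(A2)□ at `p_c(ℤ^d)` gives one-arm doubling at ratio 4** (`d ≥ 2`): re-bracketing of p1's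
`doubling_four_of_setToSetQM`. [cite: BasuSapozhnikov2017ECP, §1 (A2)] -/
theorem oneArmDoubling_four_of_setToSetQuasiMultAt {d : ℕ} (hd : 2 ≤ d) {ϰ : ℝ} (hϰ : 0 < ϰ)
    (h : SetToSetQuasiMultAt d (criticalProbI d) ϰ) :
    ∃ c : ℝ, 0 < c ∧ ∀ n : ℕ, 1 ≤ n →
      c * oneArmProb d (criticalProbI d) n ≤ oneArmProb d (criticalProbI d) (4 * n) :=
  doubling_four_of_setToSetQM hd hϰ fun m hm Z hZ X hX Y hY => by
    rw [mul_assoc]; exact h m hm Z hZ X hX Y hY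

/-- **(A2)□ at `p_c(ℤ³)` with constant `ϰ` gives `OneArmQuasiMult ∧ OneArmDoubling`.**
[cite: BasuSapozhnikov2017ECP, §1 (A2) and Thm. 1.1] -/
theorem oneArmDoubling_of_setToSetQuasiMultAt {ϰ : ℝ} (hϰ : 0 < ϰ)
    (h : SetToSetQuasiMultAt 3 (criticalProbI 3) ϰ) : OneArmQuasiMult ∧ OneArmDoubling :=
  oneArmDoubling_of_setToSetQM hϰ fun m hm Z hZ X hX Y hY => by
    rw [mul_assoc]; exact h m hm Z hZ X hX Y hY

/-- **`SetToSetQuasiMult → OneArmQuasiMult ∧ OneArmDoubling`** — Basu–Sapozhnikov's open input for the IIC of `ℤ³`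
implies the lane's (S2) conjectures. [cite: BasuSapozhnikov2017ECP, §1 (A2) and Thm. 1.1] -/
theorem oneArmDoubling_of_setToSetQuasiMult (h : SetToSetQuasiMult) : OneArmQuasiMult ∧ OneArmDoubling := by
  obtain ⟨ϰ, hϰ, hA2⟩ := h
  exact oneArmDoubling_of_setToSetQuasiMultAt hϰ hA2

end Summit.CriticalPhenomena.PercolationContinuityZ3.Theorems.Crossing

end
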